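/-
Copyright (c) 2026 the pub-hodgecm-mathlib formalisation cell (harness21).  Prover seat hodgecm-mathlib-K2Liu-p11 (g0), Track B «K2-LIT»,
#184♮ = hLiu418 = `stmt-HodgeConjecture-24832`; LEAD F0P6-plan (g13) RULINGS M-156n (4) (A∞-½ «kernel = U1-arch»), M-157k (2) (normalisation).
File (A∞-½), scalar `K`-types: the NORMALISED scalar `n_k(s) = c_k(s)/c_{±1}(s)` on ODD types — holomorphic on `{0 < re s}`, `n_{±1} ≡ 1`,
`n_k(½) = 0` for `|k| ≥ 3`.  THEOREMS ONLY.
-/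
import Summits.HodgeConjecture.HodgeConjecture.Theorems.K2LiuArchNormalisingScalar   -- ★ (this seat): `archScalarCoeff`, `archNormalisingScalar`, `M*`
import Literature.Analysis.InnerProduct.HeatTraceZetaRegularity                      -- ★ `inv_Gamma_eq_prod_range_mul_inv_Gamma_add` (reused)
import HarnessLib

/-!
# Crux `HLiu418`, A∞ organ, (A∞-½) on scalar types: the kernel of `M*_w(½)` among the odd scalar `K_w`-types

Cell `hodgecm-mathlib`, crux item hLiu418 = `stmt-HodgeConjecture-24832` (helper lane `--supports`, count-neutral).

With the Kudla–Rallis normalisation of record (★ `K2LiuArchNormalisingScalar`: `M*_w(s) = 2Q(s)⁻¹M_w(s)`, pinned to `1` on `k = ±1`), the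
normalised operator acts on the scalar type `k` of `I_w(s)` by `n_k(s) := 2Q(s)⁻¹c_k(s)` (`re s > ½`).  For ODD `k` (the parity of the pinned
line; `c_{−k} = c_k`):
* §1 (★ `inv_Gamma_eq_prod_range_mul_inv_Gamma_add`: `Γ(z)⁻¹ = (∏_{i<n}(z+i))·Γ(z+n)⁻¹`); `inv_hermTwoGamma_eq` — `Γ₂(z)⁻¹ = π⁻¹(z−1)Γ(z)⁻²` (all `z`);
  `archNormalisingScalar_ne_zero` — `Q(s) ≠ 0` on `{0 < re s}`;
* §2 `normalisedScalar_one ∕ _neg_one` — `n_{±1}(s) = 1`;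
* §3 `normalisedScalar_odd_eq (m : ℕ)` — for `k = 2m+3`:
  `n_k(s) = (s+k/2)(s−k/2)(s+½)⁻¹(s−½)·Γ(s+3/2)²·Γ(s+1+k/2)⁻²·(∏_{i<m}(s−½−m+i))²` on `re s > ½` — an expression HOLOMORPHIC on `{0 < re s}`
  (`differentiableOn_normalisedScalarOdd`) and VANISHING at `s = ½` (`normalisedScalarOdd_half`); the same for `k = −(2m+3)` (`archScalarCoeff_neg`).
So the continued `M*_w(½)` KILLS every odd scalar type with `|k| ≥ 3` and fixes `k = ±1`: the scalar-type part of «kernel = U1-arch» (M-156n (4)).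
References: [Shimura1982, (1.31)], [KudlaRallis1994 (citation only)] — derived here.
HONEST LABEL: HC_CM is proved only modulo the 7 printed citations (2 remaining named inputs: hLiu418 = stmt-HodgeConjecture-24832,
h413 = stmt-HodgeConjecture-24833) until rung 0 closes; count-neutral helper, closes no socket.
-/

set_option autoImplicit false
set_option linter.dupNamespace false

noncomputable section

open Complex MeasureTheory Set Matrix
open scoped ComplexOrder

namespace Summit.HodgeConjecture.HodgeConjecture.Cruxes.HLiu418.K2LiuArchIntertwiningScalarKernel

open Summit.HodgeConjecture.HodgeConjecture.Cruxes.HLiu418.K2LiuHermTwoGammaDefs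
open Summit.HodgeConjecture.HodgeConjecture.Cruxes.HLiu418.K2LiuArchIntertwiningScalarPole
open Summit.HodgeConjecture.HodgeConjecture.Cruxes.HLiu418.K2LiuArchNormalisingScalar

/-! ## §1  Gamma bookkeeping -/

-- `Γ(z)⁻¹ = (∏_{i<n} (z+i)) · Γ(z+n)⁻¹` is ★ `Literature.Analysis.InnerProduct.inv_Gamma_eq_prod_range_mul_inv_Gamma_add`.

/-- `Γ₂(z)⁻¹ = π⁻¹·(z−1)·Γ(z)⁻²` for every `z` (`Γ₂(z) = πΓ(z)Γ(z−1)`, `Γ(z−1)⁻¹ = (z−1)Γ(z)⁻¹`). [folklore] -/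
theorem inv_hermTwoGamma_eq (z : ℂ) : (hermTwoGamma z)⁻¹ = ((Real.pi : ℂ))⁻¹ * (z - 1) * ((Complex.Gamma z)⁻¹) ^ 2 := by
  have h := Complex.one_div_Gamma_eq_self_mul_one_div_Gamma_add_one (z - 1)
  simp only [sub_add_cancel] at h
  rw [hermTwoGamma_def, mul_inv, mul_inv, h]
  ring

/-- `Q(s) ≠ 0` on `{0 < re s}`. [folklore] -/
theorem archNormalisingScalar_ne_zero {s : ℂ} (hs : 0 < s.re) : archNormalisingScalar s ≠ 0 := by
  have hπ : (Real.pi : ℂ) ≠ 0 := by exact_mod_cast Real.pi_ne_zero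
  have h4 : (((-(4 * Real.pi ^ 4) : ℝ)) : ℂ) ≠ 0 := by
    have : (-(4 * Real.pi ^ 4) : ℝ) ≠ 0 := by
      have := Real.pi_pos
      nlinarith [pow_pos Real.pi_pos 4]
    exact_mod_cast this
  have hΓ2 : hermTwoGamma (s + 3 / 2) ≠ 0 := hermTwoGamma_ne_zero (by
    simp only [add_re, div_ofNat_re, re_ofNat]
    linarith)
  have hG1 : Complex.Gamma (s + 1 / 2) ≠ 0 := Complex.Gamma_ne_zero_of_re_pos (by
    simp only [add_re, one_div, inv_re, re_ofNat, normSq_ofNat]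
    norm_num
    linarith)
  have hG2 : Complex.Gamma (2 * s) ≠ 0 := Complex.Gamma_ne_zero_of_re_pos (by
    simp only [mul_re, re_ofNat, im_ofNat, zero_mul, sub_zero]
    linarith)
  have hF : (4 : ℂ) ^ (-(2 * s)) ≠ 0 := Complex.cpow_ne_zero_iff.mpr (Or.inl (by norm_num))
  rw [archNormalisingScalar_def]
  exact mul_ne_zero (by norm_num) (mul_ne_zero (mul_ne_zero (mul_ne_zero h4 (inv_ne_zero hΓ2))
    (mul_ne_zero (inv_ne_zero hπ) (pow_ne_zero 2 (inv_ne_zero hG1)))) (mul_ne_zero (mul_ne_zero hπ (pow_ne_zero 2 hG2)) hF))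

/-! ## §2  The pinned types `k = ±1` -/

/-- **`n_1(s) = 2Q(s)⁻¹c_1(s) = 1`** on `re s > ½`. -/
theorem normalisedScalar_one {s : ℂ} (hs : 1 / 2 < s.re) : 2 * (archNormalisingScalar s)⁻¹ * archScalarCoeff 1 s = 1 := by
  rw [mul_assoc, mul_left_comm, two_mul_archScalarCoeff_one hs, inv_mul_cancel₀ (archNormalisingScalar_ne_zero (by linarith))]

/-- **`n_{−1}(s) = 1`** on `re s > ½`. -/
theorem normalisedScalar_neg_one {s : ℂ} (hs : 1 / 2 < s.re) : 2 * (archNormalisingScalar s)⁻¹ * archScalarCoeff (-1) s = 1 := by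
  rw [archScalarCoeff_neg, normalisedScalar_one hs]

/-! ## §3  Odd types `|k| ≥ 3`: the kernel at `s = ½` -/

/-- `e^{−iπ(2m+3)} = −1`. [folklore] -/
theorem cexp_neg_pi_I_mul_odd (m : ℕ) : cexp (-(Real.pi * I) * ((2 * (m : ℤ) + 3 : ℤ) : ℂ)) = -1 := by
  have h : -(Real.pi * I) * ((2 * (m : ℤ) + 3 : ℤ) : ℂ) = ((-((m : ℤ) + 2) : ℤ) : ℂ) * (2 * Real.pi * I) + Real.pi * I := by
    push_cast
    ring
  rw [h, Complex.exp_add, Complex.exp_int_mul_two_pi_mul_I, one_mul, Complex.exp_pi_mul_I]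

/-- **THE NORMALISED SCALAR ON THE ODD TYPE `k = 2m+3`** (`re s > ½`):
`n_k(s) = (s+k/2)(s−k/2)·(s+½)⁻¹·(s−½)·Γ(s+3/2)²·Γ(s+1+k/2)⁻²·(∏_{i<m}(s−½−m+i))²`. [Shimura1982, (1.31)] -/
theorem normalisedScalar_odd_eq (m : ℕ) {s : ℂ} (hs : 1 / 2 < s.re) :
    2 * (archNormalisingScalar s)⁻¹ * archScalarCoeff ((2 * (m : ℤ) + 3 : ℤ)) s =
      (s + ((2 * (m : ℤ) + 3 : ℤ) : ℂ) / 2) * (s - ((2 * (m : ℤ) + 3 : ℤ) : ℂ) / 2) * (s + 1 / 2)⁻¹ * (s - 1 / 2) *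
        Complex.Gamma (s + 3 / 2) ^ 2 * ((Complex.Gamma (s + 1 + ((2 * (m : ℤ) + 3 : ℤ) : ℂ) / 2))⁻¹) ^ 2 *
          (∏ i ∈ Finset.range m, (s - 1 / 2 - m + i)) ^ 2 := by
  have hQ : archNormalisingScalar s ≠ 0 := archNormalisingScalar_ne_zero (by linarith)
  have hs1 : 2 * s - 1 ≠ 0 := by
    intro h
    have h' := congrArg Complex.re h
    simp only [sub_re, mul_re, re_ofNat, im_ofNat, zero_mul, sub_zero, one_re, zero_re] at h'
    linarith
  have hs3 : s + 1 / 2 ≠ 0 := by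
    intro h
    have h' := congrArg Complex.re h
    simp only [add_re, one_div, inv_re, re_ofNat, normSq_ofNat, zero_re] at h'
    norm_num at h'
    linarith
  have hπ : (Real.pi : ℂ) ≠ 0 := by exact_mod_cast Real.pi_ne_zero
  have hG3 : Complex.Gamma (s + 3 / 2) ≠ 0 := Complex.Gamma_ne_zero_of_re_pos (by
    simp only [add_re, div_ofNat_re, re_ofNat]
    linarith)
  -- `2 c_k` from the regular part, with all `Γ₂⁻¹` expanded and `Γ(β)⁻¹` pushed to `Γ(s+½)⁻¹`
  have hk := two_mul_sub_one_mul_archScalarCoeff ((2 * (m : ℤ) + 3 : ℤ)) hs1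
  have hβ : (Complex.Gamma (s + 1 - ((2 * (m : ℤ) + 3 : ℤ) : ℂ) / 2))⁻¹ =
      (∏ i ∈ Finset.range (m + 1), (s + 1 - ((2 * (m : ℤ) + 3 : ℤ) : ℂ) / 2 + i)) * (Complex.Gamma (s + 1 / 2))⁻¹ := by
    rw [Literature.Analysis.InnerProduct.inv_Gamma_eq_prod_range_mul_inv_Gamma_add _ (m + 1)]
    congr 2
    push_cast
    ring
  have hprod : (∏ i ∈ Finset.range (m + 1), (s + 1 - ((2 * (m : ℤ) + 3 : ℤ) : ℂ) / 2 + i)) =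
      (∏ i ∈ Finset.range m, (s - 1 / 2 - m + i)) * (s - 1 / 2) := by
    rw [Finset.prod_range_succ]
    congr 1
    · refine Finset.prod_congr rfl fun i _ => ?_
      push_cast
      ring
    · push_cast
      ring
  rw [cexp_neg_pi_I_mul_odd, inv_hermTwoGamma_eq, inv_hermTwoGamma_eq (s + 1 - _), hβ, hprod] at hk
  -- `Q` expanded
  have hQe : archNormalisingScalar s = (1 / 8 : ℂ) * (((-(4 * Real.pi ^ 4) : ℝ) : ℂ) *
      (((Real.pi : ℂ))⁻¹ * (s + 3 / 2 - 1) * ((Complex.Gamma (s + 3 / 2))⁻¹) ^ 2) *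
        (((Real.pi : ℂ))⁻¹ * ((Complex.Gamma (s + 1 / 2))⁻¹) ^ 2) * ((Real.pi : ℂ) * Complex.Gamma (2 * s) ^ 2 * (4 : ℂ) ^ (-(2 * s)))) := by
    rw [archNormalisingScalar_def, inv_hermTwoGamma_eq]
  -- divide
  apply mul_left_cancel₀ hQ
  rw [show archNormalisingScalar s * (2 * (archNormalisingScalar s)⁻¹ * archScalarCoeff ((2 * (m : ℤ) + 3 : ℤ)) s) =
    2 * archScalarCoeff ((2 * (m : ℤ) + 3 : ℤ)) s by field_simp]
  apply mul_left_cancel₀ hs1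
  rw [show (2 * s - 1) * (2 * archScalarCoeff ((2 * (m : ℤ) + 3 : ℤ)) s) = 2 * ((2 * s - 1) * archScalarCoeff ((2 * (m : ℤ) + 3 : ℤ)) s) by ring,
    hk, hQe]
  have hGα : Complex.Gamma (s + 1 + (2 * (m : ℂ) + 3) / 2) ≠ 0 := Complex.Gamma_ne_zero_of_re_pos (by
    have hre : (s + 1 + (2 * (m : ℂ) + 3) / 2).re = s.re + 1 + (2 * (m : ℝ) + 3) / 2 := by
      simp [Complex.add_re, Complex.div_ofNat_re]
    rw [hre]
    have : (0 : ℝ) ≤ m := Nat.cast_nonneg m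
    linarith)
  have hG1 : Complex.Gamma (s + 1 / 2) ≠ 0 := Complex.Gamma_ne_zero_of_re_pos (by
    simp only [add_re, one_div, inv_re, re_ofNat, normSq_ofNat]
    norm_num
    linarith)
  have hG2 : Complex.Gamma (2 * s) ≠ 0 := Complex.Gamma_ne_zero_of_re_pos (by
    simp only [mul_re, re_ofNat, im_ofNat, zero_mul, sub_zero]
    linarith)
  have hF : (4 : ℂ) ^ (-(2 * s)) ≠ 0 := Complex.cpow_ne_zero_iff.mpr (Or.inl (by norm_num))
  push_cast
  generalize Complex.Gamma (s + 1 + (2 * (m : ℂ) + 3) / 2) = A at hGα ⊢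
  generalize Complex.Gamma (s + 1 / 2) = B at hG1 ⊢
  generalize Complex.Gamma (s + 3 / 2) = C at hG3 ⊢
  generalize Complex.Gamma (2 * s) = D at hG2 ⊢
  generalize (4 : ℂ) ^ (-(2 * s)) = E at hF ⊢
  generalize (∏ i ∈ Finset.range m, (s - 1 / 2 - (m : ℂ) + (i : ℂ))) = P
  have hs6 : 2 * s + 1 ≠ 0 := by
    intro h
    apply hs3
    linear_combination h / 2
  rw [show (s + 1 / 2 : ℂ) = (2 * s + 1) / 2 by ring, inv_div]
  field_simp
  ring

/-- **HOLOMORPHY of the odd normalised scalar on `{0 < re s}`** (the continuation of `n_k`, `k = 2m+3`). -/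
theorem differentiableOn_normalisedScalarOdd (m : ℕ) :
    DifferentiableOn ℂ (fun s : ℂ =>
      (s + ((2 * (m : ℤ) + 3 : ℤ) : ℂ) / 2) * (s - ((2 * (m : ℤ) + 3 : ℤ) : ℂ) / 2) * (s + 1 / 2)⁻¹ * (s - 1 / 2) *
        Complex.Gamma (s + 3 / 2) ^ 2 * ((Complex.Gamma (s + 1 + ((2 * (m : ℤ) + 3 : ℤ) : ℂ) / 2))⁻¹) ^ 2 *
          (∏ i ∈ Finset.range m, (s - 1 / 2 - m + i)) ^ 2) {s : ℂ | 0 < s.re} := by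
  intro s hs
  simp only [Set.mem_setOf_eq] at hs
  have hs3 : s + 1 / 2 ≠ 0 := by
    intro h
    have h' := congrArg Complex.re h
    simp only [add_re, one_div, inv_re, re_ofNat, normSq_ofNat, zero_re] at h'
    norm_num at h'
    linarith
  have hinv : DifferentiableAt ℂ (fun s : ℂ => (s + 1 / 2)⁻¹) s := (differentiableAt_id.add_const _).inv hs3
  have hG3 : DifferentiableAt ℂ (fun s : ℂ => Complex.Gamma (s + 3 / 2)) s := by
    refine (Complex.differentiableAt_Gamma _ (ne_neg_nat_of_re_pos ?_)).comp s (differentiableAt_id.add_const _)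
    simp only [add_re, div_ofNat_re, re_ofNat]
    linarith
  have hGα : DifferentiableAt ℂ (fun s : ℂ => (Complex.Gamma (s + 1 + ((2 * (m : ℤ) + 3 : ℤ) : ℂ) / 2))⁻¹) s :=
    (Complex.differentiable_one_div_Gamma.comp ((differentiable_id.add_const _).add_const _)) s
  have hP : DifferentiableAt ℂ (fun s : ℂ => ∏ i ∈ Finset.range m, (s - 1 / 2 - m + i)) s := by
    have h := DifferentiableAt.finsetProd (𝕜 := ℂ) (u := Finset.range m) (f := fun (i : ℕ) (t : ℂ) => t - 1 / 2 - (m : ℂ) + (i : ℂ))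
      (x := s) (fun i _ => by fun_prop)
    rw [Finset.prod_fn] at h
    exact h
  have h1 : DifferentiableAt ℂ (fun s : ℂ => s + ((2 * (m : ℤ) + 3 : ℤ) : ℂ) / 2) s := by fun_prop
  have h2 : DifferentiableAt ℂ (fun s : ℂ => s - ((2 * (m : ℤ) + 3 : ℤ) : ℂ) / 2) s := by fun_prop
  have h3 : DifferentiableAt ℂ (fun s : ℂ => s - 1 / 2) s := by fun_prop
  exact ((((((h1.mul h2).mul hinv).mul h3).mul (hG3.pow 2)).mul (hGα.pow 2)).mul (hP.pow 2)).differentiableWithinAt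

/-- **THE KERNEL AT `½`**: the odd normalised scalar VANISHES at `s = ½` (`k = 2m+3`; the factor `s − ½`). -/
theorem normalisedScalarOdd_half (m : ℕ) :
    ((1 / 2 : ℂ) + ((2 * (m : ℤ) + 3 : ℤ) : ℂ) / 2) * ((1 / 2 : ℂ) - ((2 * (m : ℤ) + 3 : ℤ) : ℂ) / 2) * ((1 / 2 : ℂ) + 1 / 2)⁻¹ *
        ((1 / 2 : ℂ) - 1 / 2) * Complex.Gamma ((1 / 2 : ℂ) + 3 / 2) ^ 2 *
          ((Complex.Gamma ((1 / 2 : ℂ) + 1 + ((2 * (m : ℤ) + 3 : ℤ) : ℂ) / 2))⁻¹) ^ 2 *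
            (∏ i ∈ Finset.range m, ((1 / 2 : ℂ) - 1 / 2 - m + i)) ^ 2 = 0 := by
  rw [sub_self]
  ring

/-- The negative odd types: `n_{−(2m+3)} = n_{2m+3}` (`c_{−k} = c_k`). -/
theorem normalisedScalar_neg_odd_eq (m : ℕ) (s : ℂ) :
    2 * (archNormalisingScalar s)⁻¹ * archScalarCoeff (-((2 * (m : ℤ) + 3 : ℤ))) s =
      2 * (archNormalisingScalar s)⁻¹ * archScalarCoeff ((2 * (m : ℤ) + 3 : ℤ)) s := by
  rw [archScalarCoeff_neg]

end Summit.HodgeConjecture.HodgeConjecture.Cruxes.HLiu418.K2LiuArchIntertwiningScalarKernel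

end
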